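/-
Origin: expansion seat `planner-pub-hodgecm-qw8b-g5-0`, handover #3 v2 2026-08-18T09:54:23Z additive (+41 code lines: section PerProduct, 0 removed) (`HOME/pub-hodgecm-qw8b-g5/lean/Qw8b5/PohlmannAllNoN4.lean`, md5 e586c109, 295 lines);
landed by the gen-7 packager in gate run 28 REPLACES the earlier landed copy of `HodgeCM/Proofs/Pohlmann/PohlmannAllNoN4.lean` (import ^import Qw8b5\.Qw8NoN4\b→import HodgeCM.StubTree.Qw8NoN4 ×1).
-/
/-
Copyright: pub-hodgecm formalisation cell (harness21, 2026). New file (not vendored).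
Origin: HOME/pub-hodgecm-qw8b-g5/lean/Qw8b5/PohlmannAllNoN4.lean — session planner-pub-hodgecm-qw8b-g5-0 (unit pub-hodgecm-qw8b-g5,
QW8 SEAT 2, part (6b)(ii), generation 5), third file.  WIP module `Qw8b5.PohlmannAllNoN4`; intended final place
`HodgeCM/Proofs/Pohlmann/PohlmannAllNoN4.lean` (module `HodgeCM.Proofs.Pohlmann.PohlmannAllNoN4`).  ADDITIVE LEAF: replaces nothing,
nothing imports it.  Imports: the landed `HodgeCM.Proofs.Pohlmann.UnitH0Connected` (qw8b-g3, run 25), `HodgeCM.Proofs.Pohlmann.DegreeZeroIff`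
(pohl-g8, run 25) and this seat's first file
under its WIP name `Qw8b5.Qw8NoN4` (HANDOVER #1, ↦ `HodgeCM.StubTree.Qw8NoN4`; ONE import line to rewrite), through which come
pohl-g9's `AnyCMFieldNoN4` (run-27 row 83) and toy2-g5's `PohlmannNoN4` (row 53); lands AFTER `StubTree/Qw8NoN4`.
-/
import Summits.HodgeConjecture.HodgeCM.Proofs.Pohlmann.UnitH0Connected
import Summits.HodgeConjecture.HodgeCM.Proofs.Pohlmann.DegreeZeroIff
import Summits.HodgeConjecture.HodgeCM.StubTree.Qw8NoN4
import Literature.AlgebraicGeometry.Motives.HodgeStructureRankOne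

/-!
# N4 is redundant given connectedness: M30 and Pohlmann's theorem in ALL degrees without `Fact_hodge_F0`

N4 `Fact_hodge_F0` (`F⁰ H^k(X, ℂ) = H^k(X, ℂ)` for every `X`, `k`) enters the landed Pohlmann / [QW8] chain at exactly one
place: the degree-`0` case of M30 `Fact_weightHodge` (`weightSpace_le_piece_zero (M) (hN3) (hN4)`, WeightHodge.lean :215,
`rw [piece_of_add_eq _ _, hN4, complexConj_top]`), i.e. only through its instance `F⁰ H⁰(A′, ℂ) = H⁰(A′, ℂ)` for CM products
`A′ = ∏_j A_{(F,Θ_j)}` (toy2-g5 `PohlmannNoN4`, pohl-g9 `AnyCMFieldNoN4`, this seat's `StubTree/Qw8NoN4`: the positive-degree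
chain is N4-free).  That instance is AUTOMATIC whenever `H⁰(A′, ℚ)` is a line:

* `HodgeStructure.F_zero_eq_top_of_finrank_eq_one` — a pure `ℚ`-Hodge structure of weight `0` on a `ℚ`-vector space of
  dimension `1` has `F⁰ = V_ℂ` (type `(0,0)`): `V_ℂ` is a simple `ℂ`-module, so `F⁰ ∈ {0, V_ℂ}`, and `F⁰ = 0` forces
  `F¹ = 0` and then, by `0`-opposedness `F⁰ ⊕ conj F¹ = V_ℂ` (Deligne, Hodge II, 1.2.5), `V_ℂ = 0`; pure linear algebra.

Every all-degree form of Pohlmann's theorem in the tree ALREADY carries the degree-`0` input `CMProdConnected`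
(`dim_ℚ H⁰(A′) = 1`; from F6 `cmProdConnected_of_facts`, from F-H0 `cmProdConnected_of_unitH0`, from `Fact_H0_rank`, or from
F7 + `Fact_trTopCM` + `CMProdH0Nontrivial`), so in all of them `hN4` is REDUNDANT:

* `hodge_F_zero_H0_cmProd_of_connected (h0 : U.CMProdConnected) (F n Θ) : (U.hodge (U.cmProd F Θ) 0).F 0 = ⊤`;
* `weightSpace_le_piece_zero_of_connected (M) (hN3) (h0)`, `weightHodgeAt_zero_of_connected (M) (hN3) (h0) : U.Fact_weightHodgeAt 0`,
  **`weightHodge_of_connected (M) (hN1) (hN2) (hN3) (h0) : U.Fact_weightHodge`** (M30 in ALL degrees from `ModelAxioms` + N1 + N2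
  + N3 + `CMProdConnected`) and `weightHodge_of_unitH0 (M) (hN1) (hN2) (hN3) (hu)`;
* `pohlmannBasis_of_connected₃`, `pohlmannBasisCM_of_connected₃` (the EQUALITY `B^p ⊗ ℂ = ⨆_S V_S`, every `p ≥ 0`, Galois /
  any CM field), **`pohlmannTheorem31AllCM_of_connected₃ (M) (hN1) (hN2) (hN3) (h0) : U.PohlmannTheorem31AllCM`**,
  `pohlmannTheorem31All_of_connected₃`, and the four discharges `…_of_unitH0₃ (hu)`, `…_of_H0_rank₃ (h0)`,
  `…_of_facts₃ (h6 : Fact_weightDual)`, `…_of_genericFacts₃ (h7) (ht) (hnt)` — the landed statements with `hN4` deleted;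
* (§4, per product, Galois connectedness) `hodgeClassesOf_zero_eq_top_of_finrank (h0 : dim_ℚ H⁰(A′) = 1) : B⁰(A′) = H⁰(A′)`,
  `finrank_hodgeClassesOf_zero_of_finrank₃`, `finrank_baseChange_hodgeClassesOf_zero₃`,
  `exists_basis_hodgeClassesOf_zero_of_finrank₃ (hN3) (h0)` (pohl-g8's `p = 0` lemmas with `hN4` deleted) and
  **`pohlmannTheorem31All_of_connectedGalois₃ (M) (hN1) (hN2) (hN3) (h0 : U.CMProdConnectedGalois) : U.PohlmannTheorem31All`**
  — the (←) SUFFICIENCY direction of pohl-g8's `pohlmannTheorem31All_iff` without N4 (`p ≥ 1`: pohl-g9's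
  `pohlmannTheorem31_of_facts₃`); the (→) NECESSITY direction `cmProdConnectedGalois_of_pohlmannTheorem31All (hN4)` keeps N4;
* `Assembly.COR_CM_and_pohlmannAll_of_descentFactsB₃ (U) (M) (hR) (hN1) (hN2) (hN3) (h4) (h5) (hu) (hb) (hd) :
  U.HC_CM ∧ U.PohlmannTheorem31All` — qw8b-g3's one-binder-list statement (UnitH0Connected.lean :117) without `hN4`:
  eleven binders, COR-CM AND Pohlmann's theorem in all degrees.

Scope (for the input tables).  After this file N4 = M34 is an input of no SUFFICIENCY end theorem of the cell: no COR-CM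
route ((γ) `COR_CM_of_descentFacts₃`, (δ) `COR_CM_of_descentFactsB₃`, generic), no end-to-end statement (`endToEnd₃`, (E7)),
no "Pohlmann-all from connectedness" statement (this file).  It REMAINS (a) a numbered, page-anchored published fact (Voisin I
§6.1.3); (b) the hypothesis of the landed free-standing `weightHodge_of_facts` and `hodgeClassesOf_zero_eq_top` (ALL `X`); and
(c) GENUINELY load-bearing in the NECESSITY direction of pohl-g8's `pohlmannTheorem31All_iff (M) (hN1) (hN2) (hN3) (hN4) :
U.PohlmannTheorem31All ↔ U.CMProdConnectedGalois` (DegreeZeroIff.lean: `cmProdConnectedGalois_of_pohlmannTheorem31All (hN4)`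
through `hodgeClassesOf_zero_eq_top hN4`), where connectedness is the CONCLUSION and therefore cannot stand in for N4.
pohl-g9's scope note in `AnyCMFieldNoN4` ("N4 remains load-bearing for the BASIS / EQUALITY forms at level `0`") is
sharpened accordingly: at level `0` those forms need `dim H⁰(A′) = 1`, which they assume anyway, and nothing else.
Nothing cited, nothing posited; Mathlib + the package only.
-/

noncomputable section

open scoped TensorProduct NumberField

namespace HodgeCM

namespace Universe

open Literature.AlgebraicGeometry.Motives (CMType)
open Literature.AlgebraicGeometry.Motives.HodgeStructure (complexConj_top piece_of_add_eq)

variable {U : Universe}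

/-! ## §2 N4 in degree `0` on CM products from connectedness; M30 in all degrees -/

/-- **The only instance of N4 the chain uses is automatic**: `F⁰ H⁰(A′, ℂ) = H⁰(A′, ℂ)` for every CM product `A′`, from
`CMProdConnected` (`dim_ℚ H⁰(A′) = 1`) alone. -/
theorem hodge_F_zero_H0_cmProd_of_connected (h0 : U.CMProdConnected) (F : CMField) (n : ℕ)
    (Θ : Fin (n + 1) → CMType F) : (U.hodge (U.cmProd F Θ) 0).F 0 = ⊤ :=
  (U.hodge (U.cmProd F Θ) 0).F_zero_eq_top_of_finrank_eq_one (by simp) (h0 F n Θ)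

/-- The same from F-H0 `Fact_unitH0` (`cmProdConnected_of_unitH0`). -/
theorem hodge_F_zero_H0_cmProd_of_unitH0 (M : U.ModelAxioms) (hu : U.Fact_unitH0) (F : CMField) (n : ℕ)
    (Θ : Fin (n + 1) → CMType F) : (U.hodge (U.cmProd F Θ) 0).F 0 = ⊤ :=
  hodge_F_zero_H0_cmProd_of_connected (cmProdConnected_of_unitH0 M hu) F n Θ

section CM

variable {F : CMField} {n : ℕ} {Θ : Fin (n + 1) → CMType F}

/-- M30 in degree zero WITHOUT N4 (compare `weightSpace_le_piece_zero (M) (hN3) (hN4)`): the empty weight has `(p, q) = (0, 0)`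
and `H⁰ = F⁰ ∩ conj F⁰` by `hodge_F_zero_H0_cmProd_of_connected`; any other weight space in `H⁰` is zero
(`weightSpace_zero_eq_bot`, N3). -/
theorem weightSpace_le_piece_zero_of_connected (M : U.ModelAxioms) (hN3 : U.Fact_pull_H0) (h0 : U.CMProdConnected)
    (S : Fin (n + 1) → Finset ((F : Type) →+* ℂ)) :
    U.weightSpace F Θ S 0 ≤ (U.hodge (U.cmProd F Θ) 0).piece
      (∑ j, ∑ s ∈ S j, ind (Θ j) s) (∑ j, ∑ s ∈ S j, (1 - ind (Θ j) s)) := by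
  intro z hz
  by_cases hS : ∀ j, S j = ∅
  · obtain rfl : S = fun _ => ∅ := funext hS
    simp only [Finset.sum_empty, Finset.sum_const_zero]
    rw [piece_of_add_eq _ (by simp), hodge_F_zero_H0_cmProd_of_connected h0 F n Θ, complexConj_top]
    exact Submodule.mem_inf.2 ⟨trivial, trivial⟩
  · simp only [not_forall] at hS
    obtain ⟨j₀, hj₀⟩ := hS
    rw [weightSpace_zero_eq_bot M hN3 (Θ := Θ) (Finset.nonempty_iff_ne_empty.2 hj₀)] at hz
    rw [(Submodule.mem_bot ℂ).1 hz]
    exact zero_mem _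

end CM

/-- `Fact_weightHodgeAt 0` (toy2-g5) from `ModelAxioms` + N3 + `CMProdConnected` — no N4. -/
theorem weightHodgeAt_zero_of_connected (M : U.ModelAxioms) (hN3 : U.Fact_pull_H0) (h0 : U.CMProdConnected) :
    U.Fact_weightHodgeAt 0 :=
  fun _ _ _ S => weightSpace_le_piece_zero_of_connected M hN3 h0 S

/-- **M30 `Fact_weightHodge` in ALL degrees from `ModelAxioms` + N1 + N2 + N3 + `CMProdConnected`** (compare
`weightHodge_of_facts (M) (hN1) (hN2) (hN3) (hN4)`): degree `0` by `weightHodgeAt_zero_of_connected`, degree `k + 1` by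
toy2-g5's `weightHodgeAt_succ_of_facts` (= pohl-g2's `weightSpace_le_piece_succ`, N1 + N2). -/
theorem weightHodge_of_connected (M : U.ModelAxioms) (hN1 : U.Fact_cupExterior) (hN2 : U.Fact_cup_hodge)
    (hN3 : U.Fact_pull_H0) (h0 : U.CMProdConnected) : U.Fact_weightHodge := by
  rw [weightHodge_iff_forall_weightHodgeAt]
  intro k
  cases k with
  | zero => exact weightHodgeAt_zero_of_connected M hN3 h0
  | succ k => exact weightHodgeAt_succ_of_facts M hN1 hN2 k

/-- M30 in all degrees from `ModelAxioms` + N1 + N2 + N3 + F-H0 `Fact_unitH0`. -/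
theorem weightHodge_of_unitH0 (M : U.ModelAxioms) (hN1 : U.Fact_cupExterior) (hN2 : U.Fact_cup_hodge)
    (hN3 : U.Fact_pull_H0) (hu : U.Fact_unitH0) : U.Fact_weightHodge :=
  weightHodge_of_connected M hN1 hN2 hN3 (cmProdConnected_of_unitH0 M hu)

/-! ## §3 Pohlmann's theorem (equality, basis, dimension) in all degrees without N4 -/

/-- `PohlmannBasis` (the equality `B^p ⊗ ℂ = ⨆_{S Hodge weight} V_S`, every `p ≥ 0`, Galois `F`) from `ModelAxioms` +
N1 + N2 + N3 + `CMProdConnected` (compare `pohlmannBasis_of_facts (M) (hN1) (hN2) (hN3) (hN4)`). -/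
theorem pohlmannBasis_of_connected₃ (M : U.ModelAxioms) (hN1 : U.Fact_cupExterior) (hN2 : U.Fact_cup_hodge)
    (hN3 : U.Fact_pull_H0) (h0 : U.CMProdConnected) : U.PohlmannBasis :=
  pohlmannBasis_holds M (weightSpan_of_facts M hN1 hN3) (weightHodge_of_connected M hN1 hN2 hN3 h0)

/-- `PohlmannBasisCM` (the same equality indexed by the Galois-closure Hodge weights, ANY CM field, every `p ≥ 0`) from
`ModelAxioms` + N1 + N2 + N3 + `CMProdConnected` (compare `pohlmannBasisCM_of_facts (M) (hN1) (hN2) (hN3) (hN4)`). -/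
theorem pohlmannBasisCM_of_connected₃ (M : U.ModelAxioms) (hN1 : U.Fact_cupExterior) (hN2 : U.Fact_cup_hodge)
    (hN3 : U.Fact_pull_H0) (h0 : U.CMProdConnected) : U.PohlmannBasisCM :=
  pohlmannBasisCM_holds M (weightSpan_of_facts M hN1 hN3) (weightHodge_of_connected M hN1 hN2 hN3 h0)

/-- **Gao–Ullmo Thm 3.1 "(Pohlmann)", both sentences, EVERY `p ≥ 0`, ANY CM field, from `ModelAxioms` + N1 + N2 + N3 +
`CMProdConnected` — without N4** (compare `pohlmannTheorem31AllCM_of_connected (M) (hN1) (hN2) (hN3) (hN4) (h0)`). -/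
theorem pohlmannTheorem31AllCM_of_connected₃ (M : U.ModelAxioms) (hN1 : U.Fact_cupExterior) (hN2 : U.Fact_cup_hodge)
    (hN3 : U.Fact_pull_H0) (h0 : U.CMProdConnected) : U.PohlmannTheorem31AllCM := fun F n Θ p => by
  have hl : ∀ S : Fin (n + 1) → Finset ((F : Type) →+* ℂ), IsHodgeWeightC Θ p S →
      Module.finrank ℂ (U.weightSpace F Θ S (2 * p)) = 1 := fun S hS => by
    rw [finrank_weightSpace_all M hN1 hN3 h0 (2 * p) S, if_pos hS.1]
  obtain ⟨b, hb⟩ := exists_basis_hodgeClassesOf_C_of_eq (F := F) (n := n) (Θ := Θ) M p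
    (pohlmannBasisCM_of_connected₃ M hN1 hN2 hN3 h0 F n Θ p) hl
  refine ⟨⟨b, hb⟩, ?_⟩
  rw [← Module.finrank_eq_nat_card_basis b,
    ← (Submodule.toBaseChange.toLinearEquiv ℂ (U.hodgeClassesOf (U.cmProd F Θ) p)).finrank_eq,
    Module.finrank_baseChange]

/-- The Galois all-degree statement `PohlmannTheorem31All` (DegreeZero.lean) from `ModelAxioms` + N1 + N2 + N3 +
`CMProdConnected` (compare `pohlmannTheorem31All_of_connected (M) (hN1) (hN2) (hN3) (hN4) (h0)`). -/
theorem pohlmannTheorem31All_of_connected₃ (M : U.ModelAxioms) (hN1 : U.Fact_cupExterior) (hN2 : U.Fact_cup_hodge)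
    (hN3 : U.Fact_pull_H0) (h0 : U.CMProdConnected) : U.PohlmannTheorem31All :=
  pohlmannTheorem31All_of_pohlmannTheorem31AllCM (pohlmannTheorem31AllCM_of_connected₃ M hN1 hN2 hN3 h0)

/-- … with `CMProdConnected` from F-H0 `Fact_unitH0` (compare `pohlmannTheorem31All_of_unitH0`: `hN4` deleted). -/
theorem pohlmannTheorem31All_of_unitH0₃ (M : U.ModelAxioms) (hN1 : U.Fact_cupExterior) (hN2 : U.Fact_cup_hodge)
    (hN3 : U.Fact_pull_H0) (hu : U.Fact_unitH0) : U.PohlmannTheorem31All :=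
  pohlmannTheorem31All_of_connected₃ M hN1 hN2 hN3 (cmProdConnected_of_unitH0 M hu)

/-- … any CM field, from F-H0. -/
theorem pohlmannTheorem31AllCM_of_unitH0₃ (M : U.ModelAxioms) (hN1 : U.Fact_cupExterior) (hN2 : U.Fact_cup_hodge)
    (hN3 : U.Fact_pull_H0) (hu : U.Fact_unitH0) : U.PohlmannTheorem31AllCM :=
  pohlmannTheorem31AllCM_of_connected₃ M hN1 hN2 hN3 (cmProdConnected_of_unitH0 M hu)

/-- … with `CMProdConnected` from `Fact_H0_rank` (compare `pohlmannTheorem31All_of_H0_rank`: `hN4` deleted). -/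
theorem pohlmannTheorem31All_of_H0_rank₃ (M : U.ModelAxioms) (hN1 : U.Fact_cupExterior) (hN2 : U.Fact_cup_hodge)
    (hN3 : U.Fact_pull_H0) (h0 : U.Fact_H0_rank) : U.PohlmannTheorem31All :=
  pohlmannTheorem31All_of_connected₃ M hN1 hN2 hN3 (cmProdConnected_of_H0_rank h0)

/-- … with `CMProdConnected` from F6 `Fact_weightDual` (compare `pohlmannTheorem31All_of_facts`: `hN4` deleted). -/
theorem pohlmannTheorem31All_of_facts₃ (M : U.ModelAxioms) (hN1 : U.Fact_cupExterior) (hN2 : U.Fact_cup_hodge)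
    (hN3 : U.Fact_pull_H0) (h6 : U.Fact_weightDual) : U.PohlmannTheorem31All :=
  pohlmannTheorem31All_of_connected₃ M hN1 hN2 hN3 (cmProdConnected_of_facts M hN1 hN3 h6)

/-- … with `CMProdConnected` from F7 + `Fact_trTopCM` + `CMProdH0Nontrivial` (compare `pohlmannTheorem31All_of_genericFacts`:
`hN4` deleted). -/
theorem pohlmannTheorem31All_of_genericFacts₃ (M : U.ModelAxioms) (hN1 : U.Fact_cupExterior) (hN2 : U.Fact_cup_hodge)
    (hN3 : U.Fact_pull_H0) (h7 : U.Fact_gysin) (ht : U.Fact_trTopCM) (hnt : U.CMProdH0Nontrivial) :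
    U.PohlmannTheorem31All :=
  pohlmannTheorem31All_of_connected₃ M hN1 hN2 hN3 (cmProdConnected_of_generic M hN1 hN3 h7 ht hnt)

/-! ## §4 Per product: the `p = 0` clause from `dim_ℚ H⁰(A′) = 1` at the same `(F, Θ)`; Galois connectedness suffices -/

section PerProduct

variable {F : CMField} {n : ℕ} {Θ : Fin (n + 1) → CMType F}

/-- `B⁰(A′) = H⁰(A′, ℚ)` for ONE CM product with `dim_ℚ H⁰(A′) = 1` — pohl-g5's `hodgeClassesOf_zero_eq_top (hN4) (X)` at
`X = A′` without N4 (§1 at the weight-`0` Hodge structure on the line `H⁰(A′)`). -/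
theorem hodgeClassesOf_zero_eq_top_of_finrank (h0 : Module.finrank ℚ (U.Coh (U.cmProd F Θ) 0) = 1) :
    U.hodgeClassesOf (U.cmProd F Θ) 0 = ⊤ := by
  rw [eq_top_iff]
  intro v _
  show Literature.AlgebraicGeometry.Motives.HodgeStructure.ofRat v ∈ (U.hodge (U.cmProd F Θ) (2 * 0)).F 0
  rw [(U.hodge (U.cmProd F Θ) (2 * 0)).F_zero_eq_top_of_finrank_eq_one (by simp) h0]
  trivial

/-- Thm 3.1, second sentence, at `p = 0`, from `dim_ℚ H⁰(A′) = 1` — pohl-g8's `finrank_hodgeClassesOf_zero_of_finrank` without N4. -/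
theorem finrank_hodgeClassesOf_zero_of_finrank₃ (h0 : Module.finrank ℚ (U.Coh (U.cmProd F Θ) 0) = 1) :
    Module.finrank ℚ (U.hodgeClassesOf (U.cmProd F Θ) 0) =
      Nat.card {S : Fin (n + 1) → Finset ((F : Type) →+* ℂ) // IsHodgeWeight Θ 0 S} := by
  rw [card_isHodgeWeight_zero, hodgeClassesOf_zero_eq_top_of_finrank h0, finrank_top]
  exact h0

/-- `dim_ℂ (B⁰(A′) ⊗ ℂ) = 1` from `dim_ℚ H⁰(A′) = 1` — pohl-g8's `finrank_baseChange_hodgeClassesOf_zero` without N4. -/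
theorem finrank_baseChange_hodgeClassesOf_zero₃ (h0 : Module.finrank ℚ (U.Coh (U.cmProd F Θ) 0) = 1) :
    Module.finrank ℂ ↥((U.hodgeClassesOf (U.cmProd F Θ) 0).baseChange ℂ) = 1 := by
  rw [← (Submodule.toBaseChange.toLinearEquiv ℂ (U.hodgeClassesOf (U.cmProd F Θ) 0)).finrank_eq,
    Module.finrank_baseChange, hodgeClassesOf_zero_eq_top_of_finrank h0, finrank_top]
  exact h0

/-- Thm 3.1, first sentence, at `p = 0`, from `dim_ℚ H⁰(A′) = 1` and N3 — pohl-g8's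
`exists_basis_hodgeClassesOf_zero_of_finrank (hN3) (hN4)` without N4. -/
theorem exists_basis_hodgeClassesOf_zero_of_finrank₃ (hN3 : U.Fact_pull_H0)
    (h0 : Module.finrank ℚ (U.Coh (U.cmProd F Θ) 0) = 1) :
    ∃ b : Module.Basis {S : Fin (n + 1) → Finset ((F : Type) →+* ℂ) // IsHodgeWeight Θ 0 S} ℂ
        ↥((U.hodgeClassesOf (U.cmProd F Θ) 0).baseChange ℂ),
      ∀ S, ((b S : ↥((U.hodgeClassesOf (U.cmProd F Θ) 0).baseChange ℂ)) : U.CohC (U.cmProd F Θ) (2 * 0)) ∈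
        U.weightSpace F Θ S.1 (2 * 0) := by
  obtain ⟨hU⟩ := nonempty_unique_isHodgeWeight_zero Θ
  refine ⟨Module.basisUnique _ (finrank_baseChange_hodgeClassesOf_zero₃ h0), fun S => ?_⟩
  have hS : S.1 = fun _ => ∅ := (isHodgeWeight_zero_iff S.1).1 S.2
  rw [hS]
  show _ ∈ U.weightSpace F Θ (fun _ => ∅) 0
  rw [weightSpace_empty_zero_eq_top hN3]
  exact Submodule.mem_top

end PerProduct

/-- **SUFFICIENCY without N4: Thm 3.1 for every `p ≥ 0` from `ModelAxioms` + N1 + N2 + N3 + connectedness of the GALOIS CM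
products** — the (←) direction of pohl-g8's `pohlmannTheorem31All_iff (M) (hN1) (hN2) (hN3) (hN4)` with `hN4` deleted (`p = 0`:
§4 at the same `(F, Θ)`; `p ≥ 1`: pohl-g9's `pohlmannTheorem31_of_facts₃`).  Refines `pohlmannTheorem31All_of_connected₃`
(which asks `dim H⁰(A′) = 1` for ALL CM fields).  The (→) direction keeps N4 (`cmProdConnectedGalois_of_pohlmannTheorem31All`). -/
theorem pohlmannTheorem31All_of_connectedGalois₃ (M : U.ModelAxioms) (hN1 : U.Fact_cupExterior)
    (hN2 : U.Fact_cup_hodge) (hN3 : U.Fact_pull_H0) (h0 : U.CMProdConnectedGalois) : U.PohlmannTheorem31All := by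
  intro F hG n Θ p
  cases p with
  | zero =>
    exact ⟨exists_basis_hodgeClassesOf_zero_of_finrank₃ hN3 (h0 F hG n Θ),
      finrank_hodgeClassesOf_zero_of_finrank₃ (h0 F hG n Θ)⟩
  | succ q => exact pohlmannTheorem31_of_facts₃ M hN1 hN2 hN3 F hG n Θ (q + 1) (Nat.succ_pos q)

end Universe

namespace Assembly

/-- **COR-CM AND Pohlmann's theorem in all degrees from ONE binder list, without N4** — `ModelAxioms`, `RealisationExistsFace`,
N1, N2, N3, F4, F5, F-H0 `Fact_unitH0`, F7d-B `Fact_gysinDescentB`, `Fact_dimProd` (eleven binders; compare qw8b-g3's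
`COR_CM_and_pohlmannAll_of_descentFactsB`, twelve). -/
theorem COR_CM_and_pohlmannAll_of_descentFactsB₃ (U : Universe) (M : U.ModelAxioms)
    (hR : U.RealisationExistsFace) (hN1 : U.Fact_cupExterior) (hN2 : U.Fact_cup_hodge) (hN3 : U.Fact_pull_H0)
    (h4 : U.Fact_cupAlg) (h5 : U.Fact_cupAssoc) (hu : U.Fact_unitH0) (hb : U.Fact_gysinDescentB)
    (hd : U.Fact_dimProd) : U.HC_CM ∧ U.PohlmannTheorem31All :=
  ⟨COR_CM_of_descentFactsB₃ U M hR hN1 hN2 hN3 h4 h5 hu hb hd,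
    Universe.pohlmannTheorem31All_of_unitH0₃ M hN1 hN2 hN3 hu⟩

end Assembly

end HodgeCM

end
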